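import Summits.HodgeConjecture.HodgeConjecture.Theorems.Ring2AbelianAllWeilBaseChangeAlongQuartic
import Summits.HodgeConjecture.HodgeConjecture.Theorems.Ring2AbelianAllWeilBaseChangeRestriction
import HarnessLib

/-!
# Ring 2 · AbelianAll (ab-weil-1, gen 140, part BCA-b) — LEMMA BC ALONG `K(√a)`, geometric layer:
  `θ_a = (φ × φ) + S_a` on `B = A × A`, `P_{d,a}(θ_a) = 0`, and the lift of the Weil plane into `W_E(A × A)`

research route conditional on HC_CM; not a corollary; Q11.4-sentence-2 already refuted in dim ≥ 3.
`HC_CM` (`Theses.RankFourFaces.CMAbelianHodge`) does not occur in this file and NO open case of the Hodge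
conjecture is claimed: this is linear algebra on the tree's real carriers (`Motives.AbelianVariety.prod`,
`complexBetti`, `pullbackEigenclasses`, `weilClassesField`, `weilClassesOf`, `cupPowOne`). Bears on H2 → H1 of the
WEIL-1 brief (memo `run/shared/lean/pub/vhodge/memos/ROUTE-P2-g3.md` §4 LEMMA BC), generalising gen 139's
`E = K(√2)` (`Ring2AbelianAllWeilBaseChangeProduct/Restriction.lean`) to `E = K(√a)` for an ARBITRARY `a`
(`bcThetaAlong 2 φ = bcTheta φ`); the pay-off (the pointed statements, «R3 at ONE quartic ⟹ Weil's question for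
`ℚ(√-d)`», cyclotomic placements) is part BCA-c, `Ring2AbelianAllWeilBaseChangeAlong.lean`.

## What is proved (0 sorry)

Let `φ : A ⟶ A`, `φ ≫ φ = -(d • 𝟙 A)` (`K = ℚ(√-d)` acts on the complex abelian variety `A`), `a : ℕ`, `B := A × A`.
* `bcThetaAlong a φ = θ_a`, `θ_a(u, v) = (φu + a·v, u + φv)` (`= φ × φ + S_a`, `S_a(u,v) = (a·v, u)`, `S_a² = a`,
  so `E = K[S_a] = K(√a)` acts on `B`): `θ_a² = N_a + (a − d)`, `N_a² = −4ad`, hence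
  **`P_{d,a}(θ_a) = θ_a⁴ + (2d − 2a)θ_a² + (d + a)² = 0`** in `End B`, also in the literal `eval₂` shape of rung R3
  (`eval₂_bcThetaAlong_bcQuarticAlong`);
* **eigenvectors**: `φ^*v = νv`, `σ² = a` ⟹ `θ_a^*(p₁^*v + σp₂^*v) = (ν + σ)(p₁^*v + σp₂^*v)`; the base-changed wedge
  `w_σ(v) = ∏ (p₁^*vᵢ + σp₂^*vᵢ)` of `v₁..v_k ∈ V_ν` lies in `weilClassesField B θ_a P_{d,a} k` (`ν² = −d`);
* **the lift lands in `W_E`**: with rational weights `Σ_m r_m m^j = a^{j/2}[j even]` (`j ≤ 2n`, Vandermonde),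
  `L_r(∏vᵢ) = ½(w_{√a}(v) + w_{−√a}(v)) ∈ W_E` and `L_r (weilClassesOf A φ n d) ⊆ weilClassesField B θ_a P_{d,a} (2n)`
  (`bcLift_mem_weilClassesField_along`; `dim A = 2n`, `d ≥ 1`).

What is NOT claimed: any algebraicity; no Literature fact is introduced; no internally-minted statement is cited.

## References

* [vanGeemen1994HodgeAV] B. van Geemen, An introduction to the Hodge conjecture for abelian varieties,
  LNM 1594 (1994), 4.8–4.12.
* [MoonenZarhin1998WeilClasses] B. Moonen, Yu. Zarhin, Weil classes on abelian varieties,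
  J. reine angew. Math. 496 (1998), §1.
* [LangeBirkenhake1992] H. Lange, Ch. Birkenhake, Complex abelian varieties, Grundlehren 302 (1992), §1.1.
-/

noncomputable section

set_option linter.dupNamespace false

open CategoryTheory
open scoped BigOperators
open Literature.AlgebraicGeometry Literature.AlgebraicGeometry.Motives
open Literature.AlgebraicGeometry.HodgeTheory
open Literature.AlgebraicTopology.SingularHomology
open Summit.HodgeConjecture.HodgeConjecture.WeilTypeLadder

namespace Summit.HodgeConjecture.HodgeConjecture.Ring2.AbelianAll

variable {A : AbelianVariety ℂ} {d : ℕ}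

/-! ### §1 `θ_a = (φ × φ) + S_a` on `B = A × A` and `P_{d,a}(θ_a) = 0` -/

section Theta

variable (a : ℕ) (φ : A ⟶ A)

/-- `θ_a(u, v) = (φu + a·v, u + φv)` on `B = A × A`: `θ_a = φ × φ + S_a`, `S_a(u, v) = (a·v, u)`, `S_a² = a`. -/
def bcThetaAlong : A.prod A ⟶ A.prod A :=
  AbelianVariety.prodLift (AbelianVariety.fst A A ≫ φ + a • AbelianVariety.snd A A)
    (AbelianVariety.fst A A + AbelianVariety.snd A A ≫ φ)

/-- `N_a(u, v) = (2a·φv, 2·φu)` (`= 2 · S_a ∘ (φ × φ)`, so `θ_a² = N_a + (a − d)`). -/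
def bcNAlong : A.prod A ⟶ A.prod A :=
  AbelianVariety.prodLift ((2 * a) • (AbelianVariety.snd A A ≫ φ)) (2 • (AbelianVariety.fst A A ≫ φ))

/-- `θ_2 = θ` (the gen-139 endomorphism `bcTheta φ` of `E = K(√2)`). -/
theorem bcThetaAlong_two : bcThetaAlong 2 φ = bcTheta φ := rfl

/-- First component of `θ_a`: `p₁ ∘ θ_a = φ ∘ p₁ + a·p₂`. -/
theorem bcThetaAlong_fst : bcThetaAlong a φ ≫ AbelianVariety.fst A A =
    AbelianVariety.fst A A ≫ φ + a • AbelianVariety.snd A A := AbelianVariety.prodLift_fst _ _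

/-- Second component of `θ_a`: `p₂ ∘ θ_a = p₁ + φ ∘ p₂`. -/
theorem bcThetaAlong_snd : bcThetaAlong a φ ≫ AbelianVariety.snd A A =
    AbelianVariety.fst A A + AbelianVariety.snd A A ≫ φ := AbelianVariety.prodLift_snd _ _

/-- First component of `N_a`: `p₁ ∘ N_a = 2a·(φ ∘ p₂)`. -/
theorem bcNAlong_fst : bcNAlong a φ ≫ AbelianVariety.fst A A = (2 * a) • (AbelianVariety.snd A A ≫ φ) :=
  AbelianVariety.prodLift_fst _ _

/-- Second component of `N_a`: `p₂ ∘ N_a = 2·(φ ∘ p₁)`. -/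
theorem bcNAlong_snd : bcNAlong a φ ≫ AbelianVariety.snd A A = 2 • (AbelianVariety.fst A A ≫ φ) :=
  AbelianVariety.prodLift_snd _ _

/-- `θ_a² = N_a + (a − d)`. -/
theorem bcThetaAlong_comp_bcThetaAlong (hφ : φ ≫ φ = -(d • 𝟙 A)) :
    bcThetaAlong a φ ≫ bcThetaAlong a φ = bcNAlong a φ + ((a : ℤ) - d) • 𝟙 (A.prod A) := by
  apply AbelianVariety.prod_hom_ext
  · rw [Category.assoc, bcThetaAlong_fst, Preadditive.comp_add, Preadditive.comp_nsmul, bcThetaAlong_snd,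
      ← Category.assoc, bcThetaAlong_fst, Preadditive.add_comp, Preadditive.nsmul_comp, Category.assoc, hφ,
      Preadditive.add_comp, bcNAlong_fst, Preadditive.zsmul_comp, Category.id_comp, Preadditive.comp_neg,
      Preadditive.comp_nsmul, Category.comp_id]
    module
  · rw [Category.assoc, bcThetaAlong_snd, Preadditive.comp_add, bcThetaAlong_fst, ← Category.assoc,
      bcThetaAlong_snd, Preadditive.add_comp, Category.assoc, hφ, Preadditive.add_comp, bcNAlong_snd,
      Preadditive.zsmul_comp, Category.id_comp, Preadditive.comp_neg, Preadditive.comp_nsmul, Category.comp_id]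
    module

/-- `N_a² = −4ad`. -/
theorem bcNAlong_comp_bcNAlong (hφ : φ ≫ φ = -(d • 𝟙 A)) :
    bcNAlong a φ ≫ bcNAlong a φ = (-(4 * (a : ℤ) * d)) • 𝟙 (A.prod A) := by
  apply AbelianVariety.prod_hom_ext
  · rw [Category.assoc, bcNAlong_fst, Preadditive.comp_nsmul, ← Category.assoc, bcNAlong_snd,
      Preadditive.nsmul_comp, Category.assoc, hφ, Preadditive.zsmul_comp, Category.id_comp, Preadditive.comp_neg,
      Preadditive.comp_nsmul, Category.comp_id]
    module
  · rw [Category.assoc, bcNAlong_snd, Preadditive.comp_nsmul, ← Category.assoc, bcNAlong_fst,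
      Preadditive.nsmul_comp, Category.assoc, hφ, Preadditive.zsmul_comp, Category.id_comp, Preadditive.comp_neg,
      Preadditive.comp_nsmul, Category.comp_id]
    module

/-- Ring form: `θ_a² = N_a + (a − d)` in `End (A × A)`. -/
theorem bcThetaAlong_sq_End (hφ : φ ≫ φ = -(d • 𝟙 A)) :
    End.of (bcThetaAlong a φ) * End.of (bcThetaAlong a φ) =
      End.of (bcNAlong a φ) + ((a : ℤ) - d) • (1 : End (A.prod A)) := by
  show bcThetaAlong a φ ≫ bcThetaAlong a φ = bcNAlong a φ + ((a : ℤ) - d) • 𝟙 (A.prod A)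
  exact bcThetaAlong_comp_bcThetaAlong a φ hφ

/-- Ring form: `N_a² = −4ad` in `End (A × A)`. -/
theorem bcNAlong_sq_End (hφ : φ ≫ φ = -(d • 𝟙 A)) :
    End.of (bcNAlong a φ) * End.of (bcNAlong a φ) = (-(4 * (a : ℤ) * d)) • (1 : End (A.prod A)) := by
  show bcNAlong a φ ≫ bcNAlong a φ = (-(4 * (a : ℤ) * d)) • 𝟙 (A.prod A)
  exact bcNAlong_comp_bcNAlong a φ hφ

/-- **`P_{d,a}(θ_a) = 0`**: `θ_a⁴ + (2d − 2a)θ_a² + (d + a)² = 0` in the ring `End (A × A)`. -/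
theorem bcThetaAlong_quartic (hφ : φ ≫ φ = -(d • 𝟙 A)) :
    End.of (bcThetaAlong a φ) ^ 4 + ((2 * (d : ℤ) - 2 * a : ℤ) : End (A.prod A)) * End.of (bcThetaAlong a φ) ^ 2
      + ((((d : ℤ) + a) ^ 2 : ℤ) : End (A.prod A)) = 0 := by
  set θ : End (A.prod A) := End.of (bcThetaAlong a φ)
  set N : End (A.prod A) := End.of (bcNAlong a φ)
  have hθ : θ * θ = N + ((a : ℤ) - d) • (1 : End (A.prod A)) := bcThetaAlong_sq_End a φ hφ
  have hN : N * N = (-(4 * (a : ℤ) * d)) • (1 : End (A.prod A)) := bcNAlong_sq_End a φ hφ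
  rw [← zsmul_eq_mul, ← zsmul_one (((d : ℤ) + a) ^ 2), show (4 : ℕ) = 2 + 2 from rfl, pow_add, pow_two, hθ]
  simp only [mul_add, add_mul, hN, mul_smul_comm, smul_mul_assoc, mul_one, one_mul, smul_add, smul_smul]
  module

/-- **`P_{d,a}(θ_a) = 0` in the literal `eval₂` shape of rung R3** (`θ_a : B ⟶ B` read in `End B`). -/
theorem eval₂_bcThetaAlong_bcQuarticAlong (hφ : φ ≫ φ = -(d • 𝟙 A)) :
    Polynomial.eval₂ (Int.castRingHom (CategoryTheory.End (A.prod A)))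
      (bcThetaAlong a φ : CategoryTheory.End (A.prod A)) (bcQuarticAlong d a) = 0 := by
  rw [eval₂_bcQuarticAlong]
  exact bcThetaAlong_quartic a φ hφ

end Theta

/-! ### §2 Eigenvectors of `θ_a^*` and the `E`-Weil classes `w_σ(v)`, `σ² = a` -/

section Eigen

variable (a : ℕ) (φ : A ⟶ A)

/-- **Eigenvectors of `θ_a^*`**: for `φ^* v = ν v` and `σ² = a`,
`θ_a^*(p₁^* v + σ p₂^* v) = (ν + σ)(p₁^* v + σ p₂^* v)`. -/
theorem bcThetaAlong_eigenvector {ν σ : ℂ} (hσ : σ ^ 2 = (a : ℂ)) {v : complexBetti A.X 1}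
    (hv : v ∈ Module.End.eigenspace (complexBetti.map φ.hom.hom.hom 1).hom ν) :
    complexBetti.map (AbelianVariety.fst A A).hom.hom.hom 1 v +
        σ • complexBetti.map (AbelianVariety.snd A A).hom.hom.hom 1 v ∈
      Module.End.eigenspace (complexBetti.map (bcThetaAlong a φ).hom.hom.hom 1).hom (ν + σ) := by
  have hv' := Module.End.mem_eigenspace_iff.mp hv
  set P := complexBetti.map (AbelianVariety.fst A A).hom.hom.hom 1 v with hP
  set Q := complexBetti.map (AbelianVariety.snd A A).hom.hom.hom 1 v with hQ
  have h1 : complexBetti.map (bcThetaAlong a φ).hom.hom.hom 1 P = ν • P + a • Q := by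
    rw [hP, complexBetti_map_map_hom, bcThetaAlong_fst, complexBetti_map_add_deg_one,
      complexBetti_map_nsmul_deg_one, ← complexBetti_map_map_hom]
    change complexBetti.map (AbelianVariety.fst A A).hom.hom.hom 1
      ((complexBetti.map φ.hom.hom.hom 1).hom v) + _ = _
    rw [hv', map_smul]
  have h2 : complexBetti.map (bcThetaAlong a φ).hom.hom.hom 1 Q = P + ν • Q := by
    rw [hQ, complexBetti_map_map_hom, bcThetaAlong_snd, complexBetti_map_add_deg_one, ← complexBetti_map_map_hom]
    change _ + complexBetti.map (AbelianVariety.snd A A).hom.hom.hom 1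
      ((complexBetti.map φ.hom.hom.hom 1).hom v) = _
    rw [hv', map_smul]
  rw [Module.End.mem_eigenspace_iff, map_add, map_smul]
  change complexBetti.map (bcThetaAlong a φ).hom.hom.hom 1 P +
    σ • complexBetti.map (bcThetaAlong a φ).hom.hom.hom 1 Q = _
  rw [h1, h2]
  have haQ : a • Q = (σ ^ 2) • Q := by
    rw [hσ, ← Nat.cast_smul_eq_nsmul ℂ]
  rw [haQ]
  module

/-- The base-changed wedge `w_σ(v) = ∏ᵢ (p₁^* vᵢ + σ p₂^* vᵢ)` of `v₁, …, v_k ∈ V_ν` lies in the eigenclass space of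
the character `(x + y(ν + σ))^k` of `ℕ[θ_a]` (`σ² = a`). -/
theorem cupPowOne_baseChangeAlong_mem_pullbackEigenclasses {ν σ : ℂ} (hσ : σ ^ 2 = (a : ℂ))
    {k : ℕ} {v : Fin k → complexBetti A.X 1}
    (hv : ∀ i, v i ∈ Module.End.eigenspace (complexBetti.map φ.hom.hom.hom 1).hom ν) :
    cupPowOne ℂ (ComplexPoints (A.prod A).X) k
        (fun i => complexBetti.map (AbelianVariety.fst A A).hom.hom.hom 1 (v i) +
          σ • complexBetti.map (AbelianVariety.snd A A).hom.hom.hom 1 (v i)) ∈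
      pullbackEigenclasses (A.prod A) (bcThetaAlong a φ) k (fun x y : ℕ => ((x : ℂ) + (y : ℂ) * (ν + σ)) ^ k) := by
  have h := cupPowOne_mem_pullbackEigenclasses (A := A.prod A) (φ := bcThetaAlong a φ) (lam := fun _ => ν + σ)
    (fun i => bcThetaAlong_eigenvector a φ hσ (hv i))
  have e : (fun x y : ℕ => ∏ _i : Fin k, ((x : ℂ) + (y : ℂ) * (ν + σ))) =
      fun x y : ℕ => ((x : ℂ) + (y : ℂ) * (ν + σ)) ^ k := by
    funext x y; rw [Finset.prod_const, Finset.card_univ, Fintype.card_fin]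
  rw [e] at h
  exact h

/-- **`w_σ(v) ∈ W_E(B) = weilClassesField B θ_a P_{d,a} k`** when `ν² = −d`, `σ² = a` (`ν + σ` a root of `P_{d,a}`). -/
theorem cupPowOne_baseChangeAlong_mem_weilClassesField {ν σ : ℂ} (hν : ν ^ 2 = -(d : ℂ))
    (hσ : σ ^ 2 = (a : ℂ)) {k : ℕ} {v : Fin k → complexBetti A.X 1}
    (hv : ∀ i, v i ∈ Module.End.eigenspace (complexBetti.map φ.hom.hom.hom 1).hom ν) :
    cupPowOne ℂ (ComplexPoints (A.prod A).X) k
        (fun i => complexBetti.map (AbelianVariety.fst A A).hom.hom.hom 1 (v i) +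
          σ • complexBetti.map (AbelianVariety.snd A A).hom.hom.hom 1 (v i)) ∈
      weilClassesField (A.prod A) (bcThetaAlong a φ) (bcQuarticAlong d a) k :=
  pullbackEigenclasses_le_weilClassesField (bcQuarticAlong_root d a hν hσ)
    (cupPowOne_baseChangeAlong_mem_pullbackEigenclasses a φ hσ hv)

end Eigen

/-! ### §3 The lift `L_r` with the weights `a^{j/2}` lands in `W_E(A × A)` -/

section Lift

variable (a : ℕ)

/-- **`w_{√a}(v) + w_{−√a}(v) = 2 · Σ_s e_{|sᶜ|} τ_s(v)`** (`(√a)^j + (−√a)^j = 2 e_j`, `e_j = a^{j/2}[j even]`). -/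
theorem baseChangeAlong_add_baseChangeAlong_neg {k : ℕ} (v : Fin k → complexBetti A.X 1) :
    cupPowOne ℂ (ComplexPoints (A.prod A).X) k
        (fun i => complexBetti.map (AbelianVariety.fst A A).hom.hom.hom 1 (v i) +
          ((Real.sqrt a : ℝ) : ℂ) • complexBetti.map (AbelianVariety.snd A A).hom.hom.hom 1 (v i)) +
      cupPowOne ℂ (ComplexPoints (A.prod A).X) k
        (fun i => complexBetti.map (AbelianVariety.fst A A).hom.hom.hom 1 (v i) +
          (-((Real.sqrt a : ℝ) : ℂ)) • complexBetti.map (AbelianVariety.snd A A).hom.hom.hom 1 (v i)) =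
      (2 : ℂ) • ∑ s : Finset (Fin k), ((evenPowWeightAlong a sᶜ.card : ℚ) : ℂ) • bcTau v s := by
  classical
  rw [cupPowOne_baseChange_eq_sum, cupPowOne_baseChange_eq_sum, ← Finset.sum_add_distrib, Finset.smul_sum]
  refine Finset.sum_congr rfl fun s _ => ?_
  rw [← add_smul, smul_smul, sqrt_pow_add_neg_sqrt_pow]

/-- **`L_r(∏ vᵢ) ∈ W_E(B)`** for the weights `Σ_m r_m m^j = a^{j/2}[j even]` (`j ≤ 2n`) and `v₁, …, v_{2n} ∈ V_ν`,
`ν² = −d`: `L_r(∏ vᵢ) = ½ (w_{√a}(v) + w_{−√a}(v)) ∈ weilClassesField (A × A) θ_a P_{d,a} (2n)`. -/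
theorem bcLift_cupPowOne_mem_weilClassesField_along (φ : A ⟶ A) {n : ℕ} {r : Fin (2 * n + 1) → ℚ}
    (hr : ∀ j < 2 * n + 1, ∑ m : Fin (2 * n + 1), r m * (m : ℚ) ^ j = evenPowWeightAlong a j)
    {ν : ℂ} (hν : ν ^ 2 = -(d : ℂ)) {v : Fin (2 * n) → complexBetti A.X 1}
    (hv : ∀ i, v i ∈ Module.End.eigenspace (complexBetti.map φ.hom.hom.hom 1).hom ν) :
    bcLift A r (2 * n) (cupPowOne ℂ (ComplexPoints A.X) (2 * n) v) ∈
      weilClassesField (A.prod A) (bcThetaAlong a φ) (bcQuarticAlong d a) (2 * n) := by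
  classical
  have hσ : ((Real.sqrt a : ℝ) : ℂ) ^ 2 = (a : ℂ) := sqrt_natCast_sq a
  have hσ' : (-((Real.sqrt a : ℝ) : ℂ)) ^ 2 = (a : ℂ) := by rw [neg_sq, hσ]
  have hw := add_mem (cupPowOne_baseChangeAlong_mem_weilClassesField a φ hν hσ hv)
    (cupPowOne_baseChangeAlong_mem_weilClassesField a φ hν hσ' hv)
  rw [baseChangeAlong_add_baseChangeAlong_neg] at hw
  rw [bcLift_cupPowOne_eq hr (Nat.lt_succ_self _)]
  have h2 := Submodule.smul_mem _ (2 : ℂ)⁻¹ hw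
  rwa [smul_smul, inv_mul_cancel₀ two_ne_zero, one_smul] at h2

/-- **Every class of the Weil plane lifts into `W_E(A × A)` along `L_r`** (weights `a^{j/2}[j even]`):
`weilClassesOf A φ n d = ℂα ⊔ ℂβ`, `α, β` top wedges of eigenbases of `V±`, and `L_r α, L_r β ∈ W_E`. -/
theorem bcLift_mem_weilClassesField_along (φ : A ⟶ A) {n : ℕ} (hA : A.dim = 2 * n)
    (hd : 0 < d) (hφ : φ ≫ φ = -(d • 𝟙 A)) {r : Fin (2 * n + 1) → ℚ}
    (hr : ∀ j < 2 * n + 1, ∑ m : Fin (2 * n + 1), r m * (m : ℚ) ^ j = evenPowWeightAlong a j)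
    {c : complexBetti A.X (2 * n)} (hcW : c ∈ weilClassesOf A φ n d) :
    bcLift A r (2 * n) c ∈ weilClassesField (A.prod A) (bcThetaAlong a φ) (bcQuarticAlong d a) (2 * n) := by
  classical
  obtain ⟨v, w, hv, hw, hα0, hβ0⟩ := exists_eigenbases φ hA hd hφ
  have hΛ : HasExteriorCohomologyH1 ℂ (ComplexPoints A.X) :=
    AbelianVariety.hasExteriorCohomologyH1_complexPoints A
  have hb₁ : Module.finrank ℂ (complexBetti A.X 1) = 2 * (2 * n) := by
    rw [AbelianVariety.finrank_complexBetti_one, hA]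
  have hαE := cupPowOne_mem_weilClassesPlus φ hv
  have hβE := cupPowOne_mem_weilClassesMinus φ hw
  obtain ⟨c₁, hc₁, c₂, hc₂, rfl⟩ := Submodule.mem_sup.mp hcW
  obtain ⟨t₁, rfl⟩ := Submodule.mem_span_singleton.mp
    (weilClassesPlus_le_span_singleton hΛ hb₁ hd hφ hαE hα0 hc₁)
  obtain ⟨t₂, rfl⟩ := Submodule.mem_span_singleton.mp
    (weilClassesMinus_le_span_singleton hΛ hb₁ hd hφ hβE hβ0 hc₂)
  have hν : (Complex.I * (Real.sqrt d : ℂ)) ^ 2 = -(d : ℂ) := I_mul_sqrt_sq d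
  have hν' : (-(Complex.I * (Real.sqrt d : ℂ))) ^ 2 = -(d : ℂ) := by rw [neg_sq, hν]
  rw [map_add, map_smul, map_smul]
  exact add_mem (Submodule.smul_mem _ _ (bcLift_cupPowOne_mem_weilClassesField_along a φ hr hν hv))
    (Submodule.smul_mem _ _ (bcLift_cupPowOne_mem_weilClassesField_along a φ hr hν' hw))

end Lift

end Summit.HodgeConjecture.HodgeConjecture.Ring2.AbelianAll

end
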